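import Summits.AtomisticToContinuum.HydrodynamicLimit.Theses.AntiMazurCoboundaries
import Literature.MathematicalPhysics.KineticTheory.HardSphereEulerProofs
import Summits.AtomisticToContinuum.HydrodynamicLimit.Theorems.BoltzmannGreenKubo.Negative.TimeAverage
import Summits.AtomisticToContinuum.HydrodynamicLimit.Theorems.OneFlightGossipEngineEquilibriumStressVarianceDecayStatics
import Literature.MathematicalPhysics.KineticTheory.GoodConfigurations
import Literature.MathematicalPhysics.KineticTheory.HardSphereBBGKYLiouvilleWindow
import Literature.Analysis.FluidPDE.HardSphereTrajectoryMeasurable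
import Literature.Analysis.FluidPDE.HardSphereDynamicsProofs
import Literature.Analysis.FluidPDE.HardSphereRegularGeometry

/-!
# Mean displacement over a kinetic window under the stationary Gibbs law
# (sub-stub `stub_meanDisplacement`, W8 of the line `cutoff-compactness-net` of the crux
# `AntiMazurCoboundaries.ShearStressHalfDrude`, stmt-AtomisticToContinuum-14136)

For the homogeneous hard-sphere Gibbs law `G_N = localGibbsLaw σ a u₀ θ N Φ` (constant profiles,
`σ ≤ 1/2`, `a, θ > 0`) and every particle `i`, time `u ≥ 0` and hard-sphere flow `Φ`,

  `∫⁻ ofReal (dist_{𝕋³}(xᵢ(u), xᵢ(0))) dG_N ≤ ofReal (u · ∫ ‖v‖ dN(u₀, θ id))`.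

Proof.
* `euclidDist_flow_le_integral_norm_vel` — the deterministic path bound along a good orbit:
  `dist(xᵢ(u), xᵢ(0)) ≤ ∫₀ᵘ ‖vᵢ(s)‖ ds` (free flight moves `xᵢ` by `(t - s) vᵢ(s)` on every
  collision-free stretch, on which the velocity is constant; positions are continuous across the
  locally finitely many collisions; continuous induction on `[0, u]`);
* stationarity of `G_N` under the flow turns `∫ ∫₀ᵘ ‖vᵢ(s)‖ ds dG_N` into `u ∫ ‖vᵢ‖ dG_N`
  (`BoltzmannGreenKuboOrthMomentum.integral_window_eq`), and the velocity marginal of `G_N` is the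
  product Gaussian (`EquilibriumStressVarianceDecayC3.map_velOf_localGibbsLaw_const`), whose `i`-th
  factor is `N(u₀, θ id)`.

References: I. Gallagher, L. Saint-Raymond, B. Texier, *From Newton to Boltzmann* (2013), §4.1
(hard-sphere trajectories are piecewise free flight); H. Spohn, *Large Scale Dynamics of
Interacting Particles* (1991), Part I §2.3 (local equilibrium states).
-/

noncomputable section

namespace Summit.AtomisticToContinuum.HydrodynamicLimit.Theorems

namespace ShearStressHalfDrudeDisplacement

open MeasureTheory ProbabilityTheory Filter Set Topology
open scoped ENNReal InnerProductSpace BigOperators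
open Literature.Analysis.FluidPDE Literature.MathematicalPhysics.KineticTheory
open BoltzmannGreenKuboOrthMomentum

/-- **Path bound along a good orbit** (torus): the minimal-image displacement of particle `i`
over `[0, u]` is at most the time integral of its speed,
`dist(xᵢ(u), xᵢ(0)) ≤ ∫₀ᵘ ‖vᵢ(s)‖ ds` (free flight moves `xᵢ` by `(t - s) vᵢ(s)` on a
collision-free stretch, where the velocity is constant; positions are continuous across the
locally finitely many collisions; continuous induction). [folklore] -/
theorem euclidDist_flow_le_integral_norm_vel {d : Type*} [Fintype d] {ε : ℝ} {n : ℕ}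
    (Φ : HardSphereFlow (Torus.geometry d) ε n) {z : Config n d (UnitAddTorus d)} (hz : z ∈ Φ.good)
    (i : Fin n) {u : ℝ} (hu : 0 ≤ u) :
    Torus.euclidDist (Φ.flow u z i).1 (z i).1 ≤ ∫ s in (0 : ℝ)..u, ‖(Φ.flow s z i).2‖ := by
  have hγ := Φ.isTrajectory z hz
  -- the speed of particle `i` is measurable in time and bounded by `√(2E)`: interval integrable
  have hwm : Measurable fun s => ‖(Φ.flow s z i).2‖ :=
    ((measurable_pi_apply i).comp hγ.measurable_torus).snd.norm
  have hwi : ∀ a b : ℝ, IntervalIntegrable (fun s => ‖(Φ.flow s z i).2‖) volume a b := by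
    have hIoc : ∀ a b : ℝ, IntegrableOn (fun s => ‖(Φ.flow s z i).2‖) (Ioc a b) volume :=
      fun a b => (integrable_const (Real.sqrt (2 * configEnergy z))).mono' hwm.aestronglyMeasurable
        (Eventually.of_forall fun s => by
          rw [Real.norm_of_nonneg (norm_nonneg _)]
          exact Φ.norm_vel_flow_le hz s i)
    exact fun a b => ⟨hIoc a b, hIoc b a⟩
  have hPc : Continuous fun t => (Φ.flow t z i).1 := hγ.pos_continuous i
  set S : Set ℝ :=
    {t | Torus.euclidDist (Φ.flow t z i).1 (z i).1 ≤ ∫ s in (0 : ℝ)..t, ‖(Φ.flow s z i).2‖} with hS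
  have hSc : IsClosed S := by
    have h1 : Continuous fun t => Torus.euclidDist (Φ.flow t z i).1 (z i).1 := by
      simpa only [Function.comp_def] using
        Torus.continuous_euclidDist.comp (hPc.prodMk continuous_const)
    exact isClosed_le h1 (intervalIntegral.continuous_primitive hwi 0)
  have hmem : (0 : ℝ) ∈ S := by
    show Torus.euclidDist (Φ.flow 0 z i).1 (z i).1 ≤ ∫ s in (0 : ℝ)..0, ‖(Φ.flow s z i).2‖
    rw [Φ.flow_zero z hz, Torus.euclidDist_self, intervalIntegral.integral_same]
  have key : Icc 0 u ⊆ S := by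
    refine (hSc.inter isClosed_Icc).Icc_subset_of_forall_mem_nhdsWithin hmem ?_
    rintro x ⟨hxS, -⟩
    obtain ⟨u', hxu', hfree⟩ := hγ.exists_Ioo_right_free x
    refine mem_of_superset (Ioo_mem_nhdsGT hxu') fun t ht => ?_
    have hff : ∀ τ ∈ Ico x u',
        Φ.flow τ z = freeFlight (Torus.geometry d) (τ - x) (Φ.flow x z) :=
      fun τ hτ => hγ.eq_freeFlight_of_Ioo_free hfree hτ
    -- displacement on the free stretch `[x, t]`
    have hstep : Torus.euclidDist (Φ.flow t z i).1 (Φ.flow x z i).1 ≤ (t - x) * ‖(Φ.flow x z i).2‖ := by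
      have hPt : (Φ.flow t z i).1 = (Φ.flow x z i).1 +
          Literature.Analysis.FunctionSpaces.Torus.proj ((t - x) • (Φ.flow x z i).2) := by
        rw [hff t ⟨ht.1.le, ht.2⟩, freeFlight_apply, Torus.geometry_translate]
      rw [hPt]
      refine (euclidDist_add_proj_self_le _ _).trans (le_of_eq ?_)
      rw [norm_smul, Real.norm_of_nonneg (sub_nonneg.2 ht.1.le)]
    -- the speed is constant on the free stretch
    have hint : ∫ s in x..t, ‖(Φ.flow s z i).2‖ = (t - x) * ‖(Φ.flow x z i).2‖ := by
      have hcongr : EqOn (fun s => ‖(Φ.flow s z i).2‖) (fun _ => ‖(Φ.flow x z i).2‖) (uIcc x t) := by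
        intro s hs
        rw [uIcc_of_le ht.1.le] at hs
        show ‖(Φ.flow s z i).2‖ = ‖(Φ.flow x z i).2‖
        rw [hff s ⟨hs.1, hs.2.trans_lt ht.2⟩, freeFlight_apply]
      rw [intervalIntegral.integral_congr hcongr, intervalIntegral.integral_const, smul_eq_mul]
    show Torus.euclidDist (Φ.flow t z i).1 (z i).1 ≤ ∫ s in (0 : ℝ)..t, ‖(Φ.flow s z i).2‖
    have hxS' : Torus.euclidDist (Φ.flow x z i).1 (z i).1 ≤ ∫ s in (0 : ℝ)..x, ‖(Φ.flow s z i).2‖ :=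
      hxS
    rw [← intervalIntegral.integral_add_adjacent_intervals (hwi 0 x) (hwi x t), hint]
    calc Torus.euclidDist (Φ.flow t z i).1 (z i).1
        ≤ Torus.euclidDist (Φ.flow t z i).1 (Φ.flow x z i).1 +
            Torus.euclidDist (Φ.flow x z i).1 (z i).1 := torus_euclidDist_triangle _ _ _
      _ ≤ (t - x) * ‖(Φ.flow x z i).2‖ + ∫ s in (0 : ℝ)..x, ‖(Φ.flow s z i).2‖ :=
          add_le_add hstep hxS'
      _ = (∫ s in (0 : ℝ)..x, ‖(Φ.flow s z i).2‖) + (t - x) * ‖(Φ.flow x z i).2‖ := add_comm _ _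
  exact key ⟨hu, le_rfl⟩

/-- **W8 · mean displacement over a kinetic window.** Under the stationary homogeneous Gibbs law
`G_N = localGibbsLaw σ a u₀ θ N Φ` (`σ ≤ 1/2`, `a, θ > 0`), for every particle `i` and time
`u ≥ 0`, `E[dist_{𝕋³}(xᵢ(u), xᵢ(0))] ≤ u · ∫ ‖v‖ dN(u₀, θ id)` (pathwise
`dist ≤ ∫₀ᵘ ‖vᵢ(s)‖ ds`, stationarity, and the one-body velocity marginal `N(u₀, θ id)`).
[folklore] -/
theorem stub_meanDisplacement :
    ∀ (σ a θ : ℝ) (u₀ : V3), σ ≤ 1 / 2 → 0 < a → 0 < θ →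
    ∀ (N : ℕ) (Φ : HardSphereFlow (Torus.geometry (Fin 3)) (hsDiameter σ N) (N + 1)) (i : Fin (N + 1))
      (u : ℝ), 0 ≤ u →
      ∫⁻ z, ENNReal.ofReal (Torus.euclidDist ((Φ.flow u z i).1) ((z i).1))
          ∂(localGibbsLaw σ (fun _ => a) (fun _ => u₀) (fun _ => θ) N Φ) ≤
        ENNReal.ofReal (u * ∫ v, ‖v‖ ∂(gaussMeasure u₀ θ)) := by
  intro σ a θ u₀ hσ ha hθ N Φ i u hu
  haveI : IsProbabilityMeasure (localGibbsLaw σ (fun _ => a) (fun _ => u₀) (fun _ => θ) N Φ) :=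
    isProbabilityMeasure_localGibbsLaw continuous_const continuous_const continuous_const
      (fun _ => ha) (fun _ => hθ) hσ N Φ
  -- the speed observable `z ↦ ‖vᵢ‖`: measurable, integrable, with mean `∫ ‖v‖ dN(u₀, θ id)`
  have hXm : Measurable fun z : Config (N + 1) (Fin 3) T3 => ‖(z i).2‖ :=
    (measurable_pi_apply i).snd.norm
  have hmap := EquilibriumStressVarianceDecayC3.map_velOf_localGibbsLaw_const (σ := σ) (N := N)
    ha.le hθ u₀ Φ
  have hpi : Integrable (fun V : Fin (N + 1) → V3 => ‖V i‖)
      (Measure.pi fun _ : Fin (N + 1) => gaussMeasure u₀ θ) :=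
    (measurePreserving_eval (fun _ : Fin (N + 1) => gaussMeasure u₀ θ) i).integrable_comp_of_integrable
      (IsGaussian.integrable_id (μ := gaussMeasure u₀ θ)).norm
  have hXint : Integrable (fun z : Config (N + 1) (Fin 3) T3 => ‖(z i).2‖)
      (localGibbsLaw σ (fun _ => a) (fun _ => u₀) (fun _ => θ) N Φ) := by
    rw [← hmap] at hpi
    exact hpi.comp_measurable measurable_velOf
  have hXeq : ∫ z, ‖(z i).2‖ ∂(localGibbsLaw σ (fun _ => a) (fun _ => u₀) (fun _ => θ) N Φ) =
      ∫ v, ‖v‖ ∂(gaussMeasure u₀ θ) := by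
    have h1 : ∫ V, ‖V i‖ ∂((localGibbsLaw σ (fun _ => a) (fun _ => u₀) (fun _ => θ) N Φ).map velOf) =
        ∫ z, ‖(z i).2‖ ∂(localGibbsLaw σ (fun _ => a) (fun _ => u₀) (fun _ => θ) N Φ) :=
      integral_map measurable_velOf.aemeasurable ((continuous_apply i).norm).aestronglyMeasurable
    have h2 : ∫ v, ‖v‖ ∂((Measure.pi fun _ : Fin (N + 1) => gaussMeasure u₀ θ).map (Function.eval i)) =
        ∫ V, ‖V i‖ ∂(Measure.pi fun _ : Fin (N + 1) => gaussMeasure u₀ θ) :=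
      integral_map (measurable_pi_apply i).aemeasurable continuous_norm.aestronglyMeasurable
    rw [← h1, hmap, ← h2, (measurePreserving_eval (fun _ : Fin (N + 1) => gaussMeasure u₀ θ) i).map_eq]
  -- Step 1: the pathwise bound, almost surely (the law does not charge the bad set)
  have hae : ∀ᵐ z ∂(localGibbsLaw σ (fun _ => a) (fun _ => u₀) (fun _ => θ) N Φ),
      ENNReal.ofReal (Torus.euclidDist (Φ.flow u z i).1 (z i).1) ≤
        ENNReal.ofReal (∫ s in (0 : ℝ)..u, ‖(Φ.flow s z i).2‖) := by
    filter_upwards [ae_mem_good_localGibbsLaw' a θ u₀ Φ] with z hz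
    exact ENNReal.ofReal_le_ofReal (euclidDist_flow_le_integral_norm_vel Φ hz i hu)
  -- Step 2: integrate, using stationarity and the velocity marginal
  have hwin : Integrable (fun z => ∫ s in (0 : ℝ)..u, ‖(Φ.flow s z i).2‖)
      (localGibbsLaw σ (fun _ => a) (fun _ => u₀) (fun _ => θ) N Φ) :=
    integrable_window a θ u₀ Φ hXm hXint hu
  have hnn : 0 ≤ᵐ[localGibbsLaw σ (fun _ => a) (fun _ => u₀) (fun _ => θ) N Φ]
      fun z => ∫ s in (0 : ℝ)..u, ‖(Φ.flow s z i).2‖ :=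
    Eventually.of_forall fun z => intervalIntegral.integral_nonneg hu fun s _ => norm_nonneg _
  calc ∫⁻ z, ENNReal.ofReal (Torus.euclidDist (Φ.flow u z i).1 (z i).1)
        ∂(localGibbsLaw σ (fun _ => a) (fun _ => u₀) (fun _ => θ) N Φ)
      ≤ ∫⁻ z, ENNReal.ofReal (∫ s in (0 : ℝ)..u, ‖(Φ.flow s z i).2‖)
          ∂(localGibbsLaw σ (fun _ => a) (fun _ => u₀) (fun _ => θ) N Φ) := lintegral_mono_ae hae
    _ = ENNReal.ofReal (∫ z, (∫ s in (0 : ℝ)..u, ‖(Φ.flow s z i).2‖)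
          ∂(localGibbsLaw σ (fun _ => a) (fun _ => u₀) (fun _ => θ) N Φ)) :=
        (ofReal_integral_eq_lintegral_ofReal hwin hnn).symm
    _ = ENNReal.ofReal (u * ∫ v, ‖v‖ ∂(gaussMeasure u₀ θ)) := by
        rw [integral_window_eq a θ u₀ Φ hXm hXint hu, hXeq]

end ShearStressHalfDrudeDisplacement

end Summit.AtomisticToContinuum.HydrodynamicLimit.Theorems

end
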